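import Literature.AlgebraicGeometry.Morphisms.ProjectiveAffineCoverFibreDim
import Literature.AlgebraicGeometry.HodgeTheory.GlobalInvariantCycles
import HarnessLib

/-!
# A finite set of points of a quasi-projective scheme lies in an affine open (Liu, Prop. 3.3.36; Mumford AV §7 p. 66)

Topic `AlgebraicGeometry/Morphisms`; namespace `Literature.AlgebraicGeometry.Morphisms`; a *proofs* file (theorems only).
For a locally closed `X ⊆ ℙⁿ_k` — an open `k`-immersion `j : X → P` into a projective `k`-scheme `ι : P ↪ ℙⁿ_k`
(`HodgeTheory.IsQuasiProjectiveOver`) — and finitely many points `x₁, …, x_m ∈ X` there is an AFFINE open `U ⊆ X`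
containing all of them (`exists_isAffineOpen_forall_mem_of_isQuasiProjectiveOver`; Liu, *Algebraic Geometry and
Arithmetic Curves*, Prop. 3.3.36 (b); the input of Mumford's construction of quotients by finite groups, *Abelian
Varieties* §7, p. 66: «every finite set of points is contained in an affine open»). Proof: let `C ⊆ ℙⁿ` be the image
of the boundary `P ∖ j(X)` (closed: `ι` is a closed map); graded prime avoidance for the vanishing ideal `I(C)` and the
relevant primes of the `ι(j(xᵢ)) ∉ C` (★ `Motives.GradedPrimeAvoidance.exists_posHomog_notMem(_point)`) gives a form
`F ∈ I(C)` of positive degree with `xᵢ ∈ D₊(F)` (`Proj.exists_form_mem_basicOpen_disjoint_of_finite`); then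
`ι⁻¹D₊(F)` is an affine open of `P` (closed in the affine `D₊(F)`) missing the boundary, hence an affine open of `X`.
Cell `hodgecm-mathlib`, socket-(B) chain, (cov-2q): discharges the `hcov`/`hcov′` binders of the quotient files through
★ `AbelianSchemeConstSubgroupStableCover.translationActionOver_hcov_of_forall_finset` (B-p20 (g9)); B-p10 (g10).
Everything is proved; no named facts; no definitions. Mathlib searched and used (pin): `ProjectiveSpectrum.vanishingIdeal`,
`zeroLocus_vanishingIdeal_eq_closure`, `Proj.isAffineOpen_basicOpen`, `IsAffineOpen.preimage`,
`Scheme.Hom.isAffineOpen_iff_of_isOpenImmersion`, `Scheme.Hom.image_preimage_eq_opensRange_inf`,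
`IsClosedImmersion.base_closed`.

## References

* Q. Liu, *Algebraic Geometry and Arithmetic Curves* (2002), Prop. 3.3.36 (p. 109). [Liu2002]
* D. Mumford, *Abelian Varieties* (2nd ed. 1974), §7, proof of the Theorem (p. 66). [MumfordAV1970]
-/

noncomputable section

open CategoryTheory AlgebraicGeometry Limits TopologicalSpace Opposite

universe u

namespace Literature.AlgebraicGeometry.Morphisms

/-! ### §1 Graded level: a form vanishing on a closed set and non-vanishing at finitely many points off it -/

section Proj

variable {S : Type u} {σ : Type*} [CommRing S] [SetLike σ S] [AddSubgroupClass σ S] (𝒜 : ℕ → σ) [GradedRing 𝒜]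

/-- **Finitely many points of `Proj S` off a closed set `C` lie in a common `D₊(F)` missing `C`**, `deg F > 0`: graded
prime avoidance (★ `exists_posHomog_notMem`) inside the vanishing ideal `I(C)` (`C = V₊(I(C))` as `C` is closed) against
the finitely many relevant primes `𝔭ₓ`, `x ∈ s` — each misses a positive-degree form of `I(C)` by
★ `exists_posHomog_notMem_point` since `x ∉ C`. (Liu, Prop. 3.3.36 (a): a hypersurface containing a given closed `Z`
and missing a finite `F` disjoint from `Z`.) [cite: Liu2002, Prop. 3.3.36 (a) (p. 109)] -/
theorem Proj.exists_form_mem_basicOpen_disjoint_of_finite {C : Set (Proj 𝒜)} (hC : IsClosed C) {s : Set (Proj 𝒜)}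
    (hs : s.Finite) (hsC : Disjoint s C) :
    ∃ (d : ℕ) (F : S), 0 < d ∧ F ∈ 𝒜 d ∧ (∀ x ∈ s, x ∈ Proj.basicOpen 𝒜 F) ∧ ∀ y ∈ C, y ∉ Proj.basicOpen 𝒜 F := by
  classical
  -- `C = V₊(J)` for its vanishing ideal `J`
  set J : HomogeneousIdeal 𝒜 := ProjectiveSpectrum.vanishingIdeal C with hJ
  have hCJ : ProjectiveSpectrum.zeroLocus 𝒜 (J : Set S) = C := by
    rw [hJ, ProjectiveSpectrum.zeroLocus_vanishingIdeal_eq_closure]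
    exact hC.closure_eq
  -- each `x ∈ s` misses a positive-degree form of `J`
  have hpt : ∀ x ∈ hs.toFinset, ∃ a, Motives.GradedPrimeAvoidance.PosHomog 𝒜 J.toIdeal a ∧
      a ∉ x.asHomogeneousIdeal := fun x hx =>
    Motives.GradedPrimeAvoidance.exists_posHomog_notMem_point 𝒜 J x fun hle =>
      Set.disjoint_left.mp hsC (hs.mem_toFinset.mp hx)
        (by rw [← hCJ]; exact (ProjectiveSpectrum.mem_zeroLocus 𝒜 x _).mpr (SetLike.coe_subset_coe.mpr hle))
  obtain ⟨F, ⟨d, hd, hFd, hFJ⟩, hF⟩ := Motives.GradedPrimeAvoidance.exists_posHomog_notMem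
    hs.toFinset (fun x => x.asHomogeneousIdeal.toIdeal) (fun x _ => x.isPrime) hpt
  refine ⟨d, F, hd, hFd, fun x hx => (Proj.mem_basicOpen 𝒜 F x).mpr (hF x (hs.mem_toFinset.mpr hx)),
    fun y hy hyF => (Proj.mem_basicOpen 𝒜 F y).mp hyF ?_⟩
  exact (ProjectiveSpectrum.mem_vanishingIdeal C F).mp hFJ y hy

end Proj

/-! ### §2 Quasi-projective schemes -/

section QuasiProjective

variable {k : Type u} [Field k] {X : Motives.SchemeOver k}

/-- **A finite set of points of a quasi-projective `k`-scheme lies in an affine open** (Liu, Prop. 3.3.36 (b); Mumford,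
*Abelian Varieties* §7 p. 66). With `j : X → P` an open `k`-immersion into a projective `ι : P ↪ ℙⁿ_k`: the boundary
image `C = ι(P ∖ j(X))` is closed and misses the `ι(j(xᵢ))`; §1 gives a form `F` of positive degree vanishing on `C` with
all `ι(j(xᵢ)) ∈ D₊(F)`; `V = ι⁻¹D₊(F)` is an affine open of `P` (affine preimage of the affine `D₊(F)`) inside `j(X)`, so
`U = j⁻¹V ≅ V` is an affine open of `X` containing the `xᵢ`. [cite: Liu2002, Prop. 3.3.36 (b) (p. 109)]
[cite: MumfordAV1970, §7 Thm. p. 66 (proof)] -/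
theorem exists_isAffineOpen_forall_mem_of_isQuasiProjectiveOver (hX : HodgeTheory.IsQuasiProjectiveOver X)
    (s : Finset X.left) : ∃ U : X.left.Opens, IsAffineOpen U ∧ ∀ x ∈ s, x ∈ U := by
  classical
  obtain ⟨P, j, ⟨N, ι, hι⟩, hj⟩ := hX
  letI := MvPolynomial.gradedAlgebra (σ := Fin (N + 1)) (R := k)
  -- the immersions at their unfolded types
  set r : P.left ⟶ Proj (MvPolynomial.homogeneousSubmodule (Fin (N + 1)) k) := ι.left with hr
  haveI : IsClosedImmersion r := hι
  set jl : X.left ⟶ P.left := j.left with hjl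
  haveI : IsOpenImmersion jl := hj
  -- the boundary `C = r(P ∖ j(X))`, closed and disjoint from the images of `s`
  set C : Set ↥(Proj (MvPolynomial.homogeneousSubmodule (Fin (N + 1)) k)) :=
    r.base '' ((jl.opensRange : Set P.left)ᶜ) with hC
  have hCcl : IsClosed C := r.isClosedEmbedding.isClosedMap _ (jl.opensRange.isOpen.isClosed_compl)
  set s' : Set ↥(Proj (MvPolynomial.homogeneousSubmodule (Fin (N + 1)) k)) :=
    (fun x => r.base (jl.base x)) '' (s : Set X.left) with hs'
  have hs'fin : s'.Finite := (s.finite_toSet).image _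
  have hdisj : Disjoint s' C := by
    refine Set.disjoint_left.mpr ?_
    rintro _ ⟨x, -, rfl⟩ ⟨y, hy, hyx⟩
    apply hy
    have : y = jl.base x := r.isClosedEmbedding.injective hyx
    rw [this]
    exact ⟨x, rfl⟩
  obtain ⟨d, F, hd, hFd, hsF, hCF⟩ :=
    Proj.exists_form_mem_basicOpen_disjoint_of_finite _ hCcl hs'fin hdisj
  -- `V = r⁻¹ D₊(F)`: affine, inside the range of `j`
  have hVaff : IsAffineOpen (r ⁻¹ᵁ Proj.basicOpen _ F) := (Proj.isAffineOpen_basicOpen _ F hFd hd).preimage r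
  have hVle : r ⁻¹ᵁ Proj.basicOpen _ F ≤ jl.opensRange := by
    intro y hy
    by_contra hny
    exact hCF _ ⟨y, hny, rfl⟩ hy
  -- `U = j⁻¹ V ≅ V`
  refine ⟨jl ⁻¹ᵁ (r ⁻¹ᵁ Proj.basicOpen _ F), ?_, fun x hx => ?_⟩
  · rw [← jl.isAffineOpen_iff_of_isOpenImmersion, Scheme.Hom.image_preimage_eq_opensRange_inf,
      inf_eq_right.mpr hVle]
    exact hVaff
  · exact hsF _ ⟨x, hx, rfl⟩

end QuasiProjective

end Literature.AlgebraicGeometry.Morphisms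

end
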